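import Summits.HubbardSuperconductivity.HubbardSuperconductivity.Theorems.BalabanIRBirComplexStableXYRStubSpatialBerryZero
import Summits.HubbardSuperconductivity.HubbardSuperconductivity.Theorems.BalabanIRBirComplexStableXYRStubBerryWeightsReflect
import HarnessLib

/-!
# Crux `BirComplexStableXYR` (stmt-HubbardSuperconductivity-14845), line `fat-gaussian-defect-calculus`:
# stub E6 `stub_holonomyFormSplit` — no space–time cross terms in the Gaussian holonomy energy

Helper (`--supports`) for the crux
`Summit.HubbardSuperconductivity.HubbardSuperconductivity.Theses.BalabanIR.BirComplexStableXYR`, line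
`fat-gaussian-defect-calculus` (lead skeleton `Cruxes/BirComplexStableXYR/Lines/fat_gaussian_defect_calculus.lean`),
registered stub E6 `stub_holonomyFormSplit` (chapter 2, holonomy sectors).

**Statement.** For a finite Fourier table `c : Table r` on the window `W r = Fin r × Fin r × Fin r`
(vocabulary `Table`, `Freq`, `W` of `Theorems.BirComplexStableXY.Negative.WitnessTable`) with
(U1) charge-neutral support `Σ_w n_w = 0` (`n ∈ supp c`) and (R) time-reflection Hermiticity
`c_{n∘R} = conj c_{−n}` (`R (a,b,τ) = (a,b,rev τ)`), the real window Hessian form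
`Q(u) = Re(−Σ_n c_n (n·u)²)` of a LINEAR window configuration splits into its spatial and temporal parts:
`Q(w ↦ x w₁ + y w₂ + t w₃) = Q(w ↦ x w₁ + y w₂) + Q(w ↦ t w₃)` for all real `x, y, t`.

**Proof.** `Q(u) = −Σ_{n ∈ supp c} Re(c_n) (n·u)²` (`holSplit_hessianForm_re`).  With the spatial pairing
`A_n = Σ_w n_w (x w₁ + y w₂)` and the temporal pairing `T_n = Σ_w n_w (t w₃)` one has
`(A_n + T_n)² = A_n² + T_n² + 2 A_n T_n`, so it suffices that the cross term
`X = Σ_{n ∈ supp c} Re(c_n) A_n T_n` vanishes (`holSplit_crossTerm_eq_zero`).  The map `ι n = −(n∘R)` is a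
support-preserving involution with `c_{ι n} = conj c_n` ((R) read at `−n`, the landed `hsc_berryReflect_table_iota`), so
`Re c` is `ι`-even; `A` is `ι`-odd (`R` fixes `w₁, w₂`; `holSplit_spatial_odd`) and `T` is `ι`-even on the
support (`(rev τ : ℝ) = r − 1 − τ` and (U1): `Σ_w (−n_{Rw}) t w₃ = −t(r−1)Σ_w n_w + T_n = T_n`,
`holSplit_temporal_even`).  Hence the summand of `X` is `ι`-odd, `X = −X` (re-indexing by `ι`,
`Finset.sum_nbij'`), `X = 0`.  Consequently the Gaussian vortex-free sum of the line factorises into a real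
spatial theta series and the tilted temporal one.  No definitions; sorry-free; everything else is Mathlib.
[folklore]
-/

set_option linter.dupNamespace false -- `Summit.<S>.<S>.Theorems…` repeats the summit name (D-0017 layout)

noncomputable section

namespace Summit.HubbardSuperconductivity.HubbardSuperconductivity.Theorems.FSUnfolding

open scoped BigOperators ComplexConjugate
open Literature.Probability.LatticeModels Summit.HubbardSuperconductivity.BirComplexStableXYNegative

/-- The real window Hessian form as a real sum over the support:
`Re(−Σ_n c_n (n·u)²) = −Σ_{n ∈ supp c} Re(c_n) (n·u)²`. [folklore] -/
theorem holSplit_hessianForm_re {r : ℕ} (c : Table r) (u : W r → ℝ) :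
    (-c.sum (fun n a => a * (((∑ w, (n w : ℝ) * u w) ^ 2 : ℝ) : ℂ))).re =
      -∑ n ∈ c.support, (c n).re * (∑ w, (n w : ℝ) * u w) ^ 2 := by
  rw [Complex.neg_re, Finsupp.sum, Complex.re_sum]
  congr 1
  refine Finset.sum_congr rfl fun n _ => ?_
  rw [Complex.re_mul_ofReal]

/-- The value of the time-reflected window index, as a real number: `(rev i : ℝ) = r − 1 − i`. [folklore] -/
theorem holSplit_cast_rev {r : ℕ} (i : Fin r) :
    (((Fin.rev i : Fin r) : ℕ) : ℝ) = (r : ℝ) - 1 - ((i : ℕ) : ℝ) := by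
  rw [Fin.val_rev, Nat.cast_sub (by omega), Nat.cast_add, Nat.cast_one]
  ring

/-- Re-indexing a window sum by the time reflection `R (a,b,τ) = (a,b,rev τ)` (an involution of `W r`,
landed as `spatialBerry_reflect_involutive`). [folklore] -/
theorem holSplit_sum_refl {r : ℕ} (g : W r → ℝ) :
    ∑ w : W r, g (w.1, w.2.1, Fin.rev w.2.2) = ∑ w : W r, g w :=
  Equiv.sum_comp (spatialBerry_reflect_involutive r).toPerm g

/-- The spatial pairing `n ↦ Σ_w n_w (x w₁ + y w₂)` is ODD under `n ↦ −(n∘R)` (`R` fixes `w₁, w₂`). [folklore] -/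
theorem holSplit_spatial_odd {r : ℕ} (n : Freq r) (x y : ℝ) :
    ∑ w : W r, ((-n (w.1, w.2.1, Fin.rev w.2.2) : ℤ) : ℝ) * (x * ((w.1 : ℕ) : ℝ) + y * ((w.2.1 : ℕ) : ℝ)) =
      -∑ w : W r, (n w : ℝ) * (x * ((w.1 : ℕ) : ℝ) + y * ((w.2.1 : ℕ) : ℝ)) := by
  rw [← holSplit_sum_refl (fun w : W r => (n w : ℝ) * (x * ((w.1 : ℕ) : ℝ) + y * ((w.2.1 : ℕ) : ℝ))),
    ← Finset.sum_neg_distrib]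
  refine Finset.sum_congr rfl fun w _ => ?_
  push_cast
  ring

/-- Under (U1) the temporal pairing `n ↦ Σ_w n_w (t w₃)` is EVEN under `n ↦ −(n∘R)`:
`Σ_w (−n_{Rw}) t w₃ = −Σ_w n_w t (r − 1 − w₃) = −t(r−1) Σ_w n_w + Σ_w n_w t w₃ = Σ_w n_w t w₃`. [folklore] -/
theorem holSplit_temporal_even {r : ℕ} (n : Freq r) (hn : ∑ w, n w = 0) (t : ℝ) :
    ∑ w : W r, ((-n (w.1, w.2.1, Fin.rev w.2.2) : ℤ) : ℝ) * (t * ((w.2.2 : ℕ) : ℝ)) =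
      ∑ w : W r, (n w : ℝ) * (t * ((w.2.2 : ℕ) : ℝ)) := by
  have hn' : ∑ w : W r, (n w : ℝ) = 0 := by exact_mod_cast hn
  -- re-index the left-hand side by `R`
  have h1 : ∑ w : W r, ((-n (w.1, w.2.1, Fin.rev w.2.2) : ℤ) : ℝ) * (t * ((w.2.2 : ℕ) : ℝ)) =
      ∑ w : W r, ((-n w : ℤ) : ℝ) * (t * ((r : ℝ) - 1 - ((w.2.2 : ℕ) : ℝ))) := by
    rw [← holSplit_sum_refl (fun w : W r => ((-n w : ℤ) : ℝ) * (t * ((r : ℝ) - 1 - ((w.2.2 : ℕ) : ℝ))))]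
    refine Finset.sum_congr rfl fun w _ => ?_
    simp only [holSplit_cast_rev]
    ring
  rw [h1]
  have h2 : ∀ w : W r, ((-n w : ℤ) : ℝ) * (t * ((r : ℝ) - 1 - ((w.2.2 : ℕ) : ℝ))) =
      -(t * ((r : ℝ) - 1)) * (n w : ℝ) + (n w : ℝ) * (t * ((w.2.2 : ℕ) : ℝ)) := by
    intro w
    push_cast
    ring
  simp only [h2, Finset.sum_add_distrib, ← Finset.mul_sum, hn', mul_zero, zero_add]

/-- **The space–time cross term vanishes.**  Under (U1) and (R),
`Σ_{n ∈ supp c} Re(c_n) · (Σ_w n_w (x w₁ + y w₂)) · (Σ_w n_w t w₃) = 0`: the summand is odd under the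
support-preserving involution `ι n = −(n∘R)` (`Re c` is `ι`-even by (R), the spatial pairing `ι`-odd, the
temporal pairing `ι`-even by (U1)), so the sum equals its own negative. [folklore] -/
theorem holSplit_crossTerm_eq_zero {r : ℕ} (c : Table r) (hU1 : ∀ n ∈ c.support, ∑ w, n w = 0)
    (hR : ∀ n : Freq r, c (fun w => n (w.1, w.2.1, Fin.rev w.2.2)) = conj (c (-n))) (x y t : ℝ) :
    ∑ n ∈ c.support, (c n).re * ((∑ w, (n w : ℝ) * (x * ((w.1 : ℕ) : ℝ) + y * ((w.2.1 : ℕ) : ℝ))) *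
      (∑ w, (n w : ℝ) * (t * ((w.2.2 : ℕ) : ℝ)))) = 0 := by
  classical
  set ι : Freq r → Freq r := fun n => fun w => -n (w.1, w.2.1, Fin.rev w.2.2) with hι
  set f : Freq r → ℝ := fun n => (c n).re *
      ((∑ w, (n w : ℝ) * (x * ((w.1 : ℕ) : ℝ) + y * ((w.2.1 : ℕ) : ℝ))) *
        (∑ w, (n w : ℝ) * (t * ((w.2.2 : ℕ) : ℝ)))) with hf
  have hinvol : ∀ n : Freq r, ι (ι n) = n := by
    intro n
    funext w
    simp [hι, Fin.rev_rev]
  have hconj : ∀ n : Freq r, c (ι n) = conj (c n) := fun n => hsc_berryReflect_table_iota c hR n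
  have hmem : ∀ n ∈ c.support, ι n ∈ c.support := by
    intro n hn
    rw [Finsupp.mem_support_iff] at hn ⊢
    rw [hconj n]
    exact fun h => hn (by simpa using congrArg conj h)
  have hodd : ∀ n ∈ c.support, f (ι n) = -f n := by
    intro n hn
    simp only [hf, hι]
    rw [hsc_berryReflect_table_iota c hR n, Complex.conj_re, holSplit_spatial_odd n x y,
      holSplit_temporal_even n (hU1 n hn) t]
    ring
  have hsum : ∑ n ∈ c.support, f (ι n) = ∑ n ∈ c.support, f n :=
    Finset.sum_nbij' ι ι hmem hmem (fun n _ => hinvol n) (fun n _ => hinvol n) (fun _ _ => rfl)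
  have hneg : ∑ n ∈ c.support, f (ι n) = -∑ n ∈ c.support, f n := by
    rw [← Finset.sum_neg_distrib]
    exact Finset.sum_congr rfl hodd
  show ∑ n ∈ c.support, f n = 0
  linarith [hsum, hneg]

/-- Splitting a weighted sum of squares once the cross term vanishes:
`Σ ρ (A+T)² = Σ ρ A² + Σ ρ T²` if `Σ ρ A T = 0`. [folklore] -/
theorem holSplit_sum_sq_split {α : Type*} (s : Finset α) (ρ A T : α → ℝ)
    (hX : ∑ n ∈ s, ρ n * (A n * T n) = 0) :
    -∑ n ∈ s, ρ n * (A n + T n) ^ 2 = -∑ n ∈ s, ρ n * A n ^ 2 + -∑ n ∈ s, ρ n * T n ^ 2 := by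
  have h : ∀ n ∈ s, ρ n * (A n + T n) ^ 2 = ρ n * A n ^ 2 + ρ n * T n ^ 2 + 2 * (ρ n * (A n * T n)) := by
    intro n _
    ring
  rw [Finset.sum_congr rfl h, Finset.sum_add_distrib, Finset.sum_add_distrib, ← Finset.mul_sum, hX]
  ring

/-- **Registered stub E6 `stub_holonomyFormSplit` (verbatim signature): no space–time cross terms in the
Gaussian holonomy energy.**  Under (U1) and (R) the real window Hessian form
`Q(u) = Re(−Σ_n c_n (n·u)²)` of a linear configuration splits,
`Q(w ↦ x w₁ + y w₂ + t w₃) = Q(w ↦ x w₁ + y w₂) + Q(w ↦ t w₃)`: the cross term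
`Σ_n Re(c_n) (Σ_w n_w (x w₁ + y w₂)) (Σ_w n_w t w₃)` is odd under the support-preserving involution
`n ↦ −(n∘R)` (`Re c` even by (R), the spatial pairing odd, the temporal pairing even by (U1)) and hence
vanishes (`holSplit_crossTerm_eq_zero`).  So the Gaussian vortex-free sum factorises into a real spatial
theta series and the tilted temporal one. [folklore] -/
theorem stub_holonomyFormSplit :
    ∀ (r : ℕ) (c : Table r), (∀ n ∈ c.support, ∑ w, n w = 0) →
      (∀ n : Freq r, c (fun w => n (w.1, w.2.1, Fin.rev w.2.2)) = (starRingEnd ℂ) (c (-n))) →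
      ∀ (Q : (W r → ℝ) → ℝ),
      (∀ u : W r → ℝ, Q u = (-c.sum (fun n a => a * (((∑ w, (n w : ℝ) * u w) ^ 2 : ℝ) : ℂ))).re) →
      ∀ (x y t : ℝ),
        Q (fun w => x * ((w.1 : ℕ) : ℝ) + y * ((w.2.1 : ℕ) : ℝ) + t * ((w.2.2 : ℕ) : ℝ)) =
          Q (fun w => x * ((w.1 : ℕ) : ℝ) + y * ((w.2.1 : ℕ) : ℝ)) + Q (fun w => t * ((w.2.2 : ℕ) : ℝ)) := by
  intro r c hU1 hR Q hQ x y t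
  have hX := holSplit_crossTerm_eq_zero c hU1 hR x y t
  rw [hQ, hQ, hQ, holSplit_hessianForm_re, holSplit_hessianForm_re, holSplit_hessianForm_re]
  -- split the full pairing into its spatial and temporal parts
  have hpair : ∀ n : Freq r,
      (∑ w : W r, (n w : ℝ) * (x * ((w.1 : ℕ) : ℝ) + y * ((w.2.1 : ℕ) : ℝ) + t * ((w.2.2 : ℕ) : ℝ))) =
        (∑ w : W r, (n w : ℝ) * (x * ((w.1 : ℕ) : ℝ) + y * ((w.2.1 : ℕ) : ℝ))) +
          ∑ w : W r, (n w : ℝ) * (t * ((w.2.2 : ℕ) : ℝ)) := by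
    intro n
    rw [← Finset.sum_add_distrib]
    exact Finset.sum_congr rfl fun w _ => by ring
  calc -∑ n ∈ c.support, (c n).re *
        (∑ w : W r, (n w : ℝ) * (x * ((w.1 : ℕ) : ℝ) + y * ((w.2.1 : ℕ) : ℝ) + t * ((w.2.2 : ℕ) : ℝ))) ^ 2
      = -∑ n ∈ c.support, (c n).re *
          ((∑ w : W r, (n w : ℝ) * (x * ((w.1 : ℕ) : ℝ) + y * ((w.2.1 : ℕ) : ℝ))) +
            ∑ w : W r, (n w : ℝ) * (t * ((w.2.2 : ℕ) : ℝ))) ^ 2 := by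
        congr 1
        exact Finset.sum_congr rfl fun n _ => by rw [hpair n]
    _ = -∑ n ∈ c.support, (c n).re *
            (∑ w : W r, (n w : ℝ) * (x * ((w.1 : ℕ) : ℝ) + y * ((w.2.1 : ℕ) : ℝ))) ^ 2 +
          -∑ n ∈ c.support, (c n).re * (∑ w : W r, (n w : ℝ) * (t * ((w.2.2 : ℕ) : ℝ))) ^ 2 :=
        holSplit_sum_sq_split c.support (fun n => (c n).re)
          (fun n => ∑ w : W r, (n w : ℝ) * (x * ((w.1 : ℕ) : ℝ) + y * ((w.2.1 : ℕ) : ℝ)))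
          (fun n => ∑ w : W r, (n w : ℝ) * (t * ((w.2.2 : ℕ) : ℝ))) hX

end Summit.HubbardSuperconductivity.HubbardSuperconductivity.Theorems.FSUnfolding

end
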